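import Summits.BirchSwinnertonDyer.BirchSwinnertonDyer.Theorems.ByReductionTypeAtTwoRankOneAtTwoOneDoorLawFirstLayerDefs
import Summits.BirchSwinnertonDyer.BirchSwinnertonDyer.Theorems.ByReductionTypeAtTwoRankOneAtTwoBigImageOddLocalOneDoorSubsliceNegDiscConverse
import Summits.BirchSwinnertonDyer.Rank1Residual.F1Sign2.CasselsTateSignAtTwo
import HarnessLib

/-!
# ES-27 (cell bsd-f1-sign2, seat -es g18): THE SECOND LAYER AT A MINIMAL ARCHIMEDEAN DOOR — a typed θ-split of the lead's residue R_N

Sketch only (planner seat; nothing here is proposed to the tree by this seat; the typer ports).  Crux `RankOneAtTwoBigImageOddLocal`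
(stmt-BirchSwinnertonDyer-23715), LINE v8.17 `one_door_analytic`, registered stub `stub_residueNonEgg : S_pub4 → DoorIndexLawFullCAtTwoSomeDoorResidueNonEgg`.

Frame (Kramer 1981, Prop. 3 and Prop. 6; elementary Selmer comparison).  `W` of the slice with `Δ_W > 0`, `Ш(W)[2] = 0`, `E(ℚ) ⊂ E⁰(ℝ)`; `K = ℚ(√d_K)`
with `d_K` door-admissible and the door MINIMAL (`t = s = 0`).  Then `Sel₂(W^{(d_K)}/ℚ) = ⟨κ(P_W), u⟩ ≅ 𝔽₂²` (the egg twist law, `#Sel₂ = 4`), so at a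
door with `L(W^{(d_K)}, 1) ≠ 0` one has `Ш(W^{(d_K)})[2^∞] ≅ (ℤ/2^a)²` with `a ≥ 1`, and the AN-28c identity `2m + [Δ_W<0] = s_W + s_d + t + 2s + 2v₂(c)`
reads `m = a + v₂(c)`.  Its first layer `m ≥ v₂(c) + 1` is U₀'s contrapositive (tree, theorem modulo print:
`doorIndexLawUpperCAtTwoBottom_of_print_ctFree`).  The SECOND layer is the bit `a = 1` versus `a ≥ 2`, i.e. the Cassels–Tate bit of the twin on its
`2`-Selmer plane: `θ = −` ⟺ `Ш(Wd)[2] ∩ 2Ш(Wd)[4] = 0` ⟺ `¬ ShaTwoInTwiceShaFour Wd` ⟺ `#Ш(Wd)[2^∞] = 4` — BSD-free decidable per row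
(PARI `ellrank(E^d) = [0,0,2]`), as is the Heegner exponent `m` (ENGINE S AJ-matching).  The three statements below split R_N along `θ`:

* L₁ `HeegnerExponentAtShaFourMinimalDoorNonEggAtTwo` (converse half, second bit): `#Ш(Wd)[2^∞] = 4 ⟹ m = v₂(c) + 1`;
* U₁ `HeegnerExponentLowerBoundAtShaDeepMinimalDoorNonEggAtTwo` (Euler-system half, second rung): `ShaTwoInTwiceShaFour Wd ⟹ m ≥ v₂(c) + 2`;
* SUPPLY₄ `ShaFourMinimalDoorSupplyNonEggAtTwo`: every R_N curve has a non-vanishing minimal admissible Heegner door datum with `#Ш(Wd)[2^∞] = 4`;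

and the import-free glue `L₁ ∧ SUPPLY₄ ⟹ R_N` (`residueNonEgg_of_shaFourDoor`).  Census (BC5 witness): ENGINE S j307611 re-read (48 R_N minimal-door index rows:
`θ = −` 33/33 with `m = 1`; `θ = +` 15/15 with `m ≥ 2`) + ENGINE S27 (this seat's kit job, supply over 16 minimal doors per R_N curve).
-/

noncomputable section

open scoped Classical

set_option linter.dupNamespace false

namespace Summit.BirchSwinnertonDyer.BirchSwinnertonDyer.Theorems.RankOneAtTwoOneDoor

open Literature.NumberTheory.EllipticCurves Literature.NumberTheory.EllipticCurves.ModularForms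
  Summit.BirchSwinnertonDyer.Rank1Residual.F1Sign2

/-- **L₁ `HeegnerExponentAtShaFourMinimalDoorNonEggAtTwo` — THE SECOND BIT OF THE CONVERSE HALF AT A MINIMAL ARCHIMEDEAN DOOR (CONJECTURE, ES-27L).**
`W/ℚ` globally minimal, non-CM, `ρ_{W,2^n}` onto for all `n`, odd torsion order, odd Tamagawa product, analytic rank `1`, `Δ_W > 0`, `Ш(W)[2] = 0`,
`E(ℚ) ⊂ E⁰(ℝ)` (`¬ MeetsEgg W`); `K` imaginary quadratic with `d_K` door-admissible and the door MINIMAL (`t = s = 0`), `(d_K, N_W) = 1`, the Heegner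
hypothesis; `Wd` a globally minimal model of `W^{(d_K)}` with `#Ш(Wd)[2^∞] = 4` (⟺ rank `Wd(ℚ) = 0` and the Cassels–Tate form on `Sel₂(Wd) ≅ 𝔽₂²`
non-degenerate; PARI `ellrank = [0,0,2]`); `Dt` ANY parametrisation datum of level `N_W`, `H`, `ι`, `P ∈ E(K)` over the complex Heegner point.  THEN the
exact `2`-divisibility exponent of `P` modulo torsion is `v₂(c) + 1`.  It is AN-28c `DoorIndexLawFullCAtTwo` restricted to the locus
`(s_W, s_d, t, s) = (0, 2, 0, 0)`; with U₀ (`m ≥ v₂(c)+1` here, theorem modulo print) only `m ≤ v₂(c) + 1` is open: «a Heegner point divisible by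
`2^{v₂(c)+2}` modulo torsion forces `Ш(Wd)[4] ≠ Ш(Wd)[2]`», the `M = 4` layer of the converse (Kolyvagin-exactness) direction at `p = 2`.
Why it might fail: second Kolyvagin layer at `2` in the converse direction (no eigenspaces for complex conjugation on `E[4]`; the twist character
enters the Cassels–Tate pairing at level `4`); a single certified row `ellrank(E^d) = [0,0,2]` with `m ≥ 2` refutes it.  Census: ENGINE S j307611,
`Δ > 0` minimal-door index rows with `ellrank(E) = [1,1,0]`, `ellrank(E^d) = [0,0,2]`: `m = 1` on 33/33 (BSD-free on both sides); ENGINE S27 (g18).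
[cite: GrossLMS1991, Conj. 1.2, §3 and §10] [cite: Kramer1981, Prop. 3 and Prop. 6] [cite: Kolyvagin1990, Thm. A] [cite: GrossZagier1986, Thm. I.6.3 and V.§2] -/
@[conjecture] def HeegnerExponentAtShaFourMinimalDoorNonEggAtTwo : Prop :=
  ∀ (W : WeierstrassCurve ℚ) [W.IsElliptic] [W.IsGloballyMinimal] [NeZero (W.conductorNorm ℤ)],
    ¬ W.HasCM → (∀ n : ℕ, W.HasSurjectiveModNGaloisRep ((2 ^ n : ℕ) : ℤ)) → Odd W.torsionOrder → Odd W.tamagawaProduct →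
    W.analyticRank = 1 → 0 < W.Δ → ShaTwoTrivial W → ¬ MeetsEgg W →
    ∀ (K : Type) [Field K] [NumberField K], IsImaginaryQuadratic K →
      DoorAdmissible W (NumberField.discr K) →
      transpCount W (NumberField.discr K) + 2 * identCount W (NumberField.discr K) = 0 →
      Nat.Coprime (NumberField.discr K).natAbs (W.conductorNorm ℤ) → SatisfiesHeegnerHypothesis (W.conductorNorm ℤ) K →
      ∀ (Wd : WeierstrassCurve ℚ) [Wd.IsElliptic] [Wd.IsGloballyMinimal] (Cd : WeierstrassCurve.VariableChange ℚ),
        Cd • W.quadraticTwist (NumberField.discr K : ℚ) = Wd →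
        Nat.card (AddCommGroup.primaryComponent Wd.sha 2) = 4 →
      ∀ (Dt : ModularParametrizationData W (W.conductorNorm ℤ))
        (H : HeegnerDatum (W.conductorNorm ℤ) (NumberField.discr K)) (ι : K →+* ℂ)
        (P : (W.baseChange K).toAffine.Point),
        WeierstrassCurve.Affine.Point.map ι.toRatAlgHom P = heegnerPointComplex Dt H →
        HasTwoDivisibilityUpToTorsion W K P (padicValInt 2 Dt.c + 1)

/-- **U₁ `HeegnerExponentLowerBoundAtShaDeepMinimalDoorNonEggAtTwo` — THE SECOND RUNG OF THE EULER-SYSTEM HALF AT A MINIMAL ARCHIMEDEAN DOOR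
(CONJECTURE, ES-27U).**  Same slice and door as L₁; `Wd` a globally minimal model of the twin with `Ш(Wd)[2] ⊆ 2Ш(Wd)[4]` (`ShaTwoInTwiceShaFour Wd`: the
Cassels–Tate form on `Sel₂(Wd)` is identically zero; at a rank-`0` door this is `Ш(Wd)[2^∞] ≅ (ℤ/2^a)²` with `a ≥ 2`; PARI `ellrank = [0,2,0]`).  THEN
every exact `2`-divisibility exponent `m` of `P` modulo torsion satisfies `m ≥ v₂(c) + 2` (the Heegner point is divisible by `2^{v₂(c)+2}` modulo
torsion).  It is `DoorIndexLawUpperCAtTwo` at the locus `s_d ≥ 4` of a minimal archimedean door — the rung after the PROVED bottom rung U₀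
(`doorIndexLawUpperCAtTwoBottom_of_print_ctFree`: `Sel₂(Wd) ≠ 0 ⟹ m ≥ v₂(c)+1`, from Gross's Prop. 3.7(2) mod `2`); this rung needs the
mod-`4` localisation of the Kolyvagin classes `c(1), c(ℓ)` (McCallum) and is route GenusKolyvaginAtTwo's `U_T` at `M = 4` in one-door currency.
Why it might fail: the mod-`4` Kolyvagin relation at `2` needs `E[4]`-level Chebotarev primes and the sign `ε = −1` bookkeeping without
eigenspaces; a certified rank-`0` row with `ellrank(E^d) = [0,2,0]` and `m = v₂(c)+1` refutes it.  Census: ENGINE S j307611, `Δ > 0` minimal-door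
index rows with `ellrank(E) = [1,1,0]`, `ellrank(E^d) = [0,2,0]`, `L(E^d,1) ≠ 0`: `m ≥ 2` on 15/15 (`m = 2`: 11, `3`: 3, `4`: 1; BSD shadow
`#Ш_an(E^d) = 4^m` 15/15); ENGINE S27 (g18). [cite: GrossLMS1991, Prop. 3.7 and §10] [cite: McCallum1991, Thm. 5.1 (shape only)] [cite: Kolyvagin1990, Thm. A] -/
@[conjecture] def HeegnerExponentLowerBoundAtShaDeepMinimalDoorNonEggAtTwo : Prop :=
  ∀ (W : WeierstrassCurve ℚ) [W.IsElliptic] [W.IsGloballyMinimal] [NeZero (W.conductorNorm ℤ)],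
    ¬ W.HasCM → (∀ n : ℕ, W.HasSurjectiveModNGaloisRep ((2 ^ n : ℕ) : ℤ)) → Odd W.torsionOrder → Odd W.tamagawaProduct →
    W.analyticRank = 1 → 0 < W.Δ → ShaTwoTrivial W → ¬ MeetsEgg W →
    ∀ (K : Type) [Field K] [NumberField K], IsImaginaryQuadratic K →
      DoorAdmissible W (NumberField.discr K) →
      transpCount W (NumberField.discr K) + 2 * identCount W (NumberField.discr K) = 0 →
      Nat.Coprime (NumberField.discr K).natAbs (W.conductorNorm ℤ) → SatisfiesHeegnerHypothesis (W.conductorNorm ℤ) K →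
      ∀ (Wd : WeierstrassCurve ℚ) [Wd.IsElliptic] [Wd.IsGloballyMinimal] (Cd : WeierstrassCurve.VariableChange ℚ),
        Cd • W.quadraticTwist (NumberField.discr K : ℚ) = Wd →
        ShaTwoInTwiceShaFour Wd →
      ∀ (Dt : ModularParametrizationData W (W.conductorNorm ℤ))
        (H : HeegnerDatum (W.conductorNorm ℤ) (NumberField.discr K)) (ι : K →+* ℂ)
        (P : (W.baseChange K).toAffine.Point),
        WeierstrassCurve.Affine.Point.map ι.toRatAlgHom P = heegnerPointComplex Dt H →
        ∀ m : ℕ, HasTwoDivisibilityUpToTorsion W K P m → padicValInt 2 Dt.c + 2 ≤ m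

/-- **SUPPLY₄ `ShaFourMinimalDoorSupplyNonEggAtTwo` — EVERY R_N CURVE HAS A MINIMAL DOOR WHOSE TWIN HAS `#Ш[2^∞] = 4` (CONJECTURE, ES-27S).**
`W` of the slice with `Δ_W > 0`, `Ш(W)[2] = 0`, `E(ℚ) ⊂ E⁰(ℝ)`.  THEN there is an imaginary quadratic `K` with `d_K` door-admissible, the door minimal
(`t = s = 0`), `(d_K, N_W) = 1`, the Heegner hypothesis, `L(W^{(d_K)}, 1) ≠ 0`, a parametrisation datum `Dt`, `H`, `ι`, a point `P ∈ E(K)` over the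
complex Heegner point, and a globally minimal model `Wd` of the twist with `#Ш(Wd)[2^∞] = 4`.  The datum `(Dt, H, ι, P)` exists at every Heegner door
(modularity; Gross 1991 §3); the content is the DOOR: among the minimal admissible Heegner doors of `W` (all of which have `#Sel₂(Wd) = 4` by the
egg twist law) one has analytic rank `0` AND Cassels–Tate bit `θ = −`.  A Chebotarev / governing-field statement in the style of Smith's
`2^∞`-Selmer distribution is the expected mechanism (is `θ(W^{(d)})` an affine function of the square class of `d` on the fixed plane
`⟨κ(P), u⟩`?).  Why it might fail: a curve all of whose rank-`0` minimal doors have `Ш(Wd)[4] ≠ Ш(Wd)[2]` (a governing obstruction forcing `θ = +`);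
the non-vanishing conjunct is Hoffstein–Luo-type but must be met SIMULTANEOUSLY with `θ = −`.  Census: ENGINE S j307611 first minimal doors of the
55 identified R_N curves: `θ = −` at 39/55 first doors; -desc §27 CTL1-noegg 24/31 rank-`0` doors; ENGINE S27 (g18): position of the first `θ = −`
door over 16 minimal doors per R_N curve. [cite: Kramer1981, Prop. 6] [cite: Smith2016GoverningFields, Thm. 1.1 (shape only)] [cite: HoffsteinLuo1997, Thm.]
[cite: GrossLMS1991, §3] -/
@[conjecture] def ShaFourMinimalDoorSupplyNonEggAtTwo : Prop :=
  ∀ (W : WeierstrassCurve ℚ) [W.IsElliptic] [W.IsGloballyMinimal] [NeZero (W.conductorNorm ℤ)],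
    ¬ W.HasCM → (∀ n : ℕ, W.HasSurjectiveModNGaloisRep ((2 ^ n : ℕ) : ℤ)) → Odd W.torsionOrder → Odd W.tamagawaProduct →
    W.analyticRank = 1 → 0 < W.Δ → ShaTwoTrivial W → ¬ MeetsEgg W →
    ∃ (K : Type) (_ : Field K) (_ : NumberField K), IsImaginaryQuadratic K ∧ DoorAdmissible W (NumberField.discr K) ∧
      transpCount W (NumberField.discr K) + 2 * identCount W (NumberField.discr K) = 0 ∧
      Nat.Coprime (NumberField.discr K).natAbs (W.conductorNorm ℤ) ∧ SatisfiesHeegnerHypothesis (W.conductorNorm ℤ) K ∧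
      (W.quadraticTwist (NumberField.discr K : ℚ)).entireLFunction 1 ≠ 0 ∧
      ∃ (Dt : ModularParametrizationData W (W.conductorNorm ℤ)) (H : HeegnerDatum (W.conductorNorm ℤ) (NumberField.discr K))
        (ι : K →+* ℂ) (P : (W.baseChange K).toAffine.Point) (Wd : WeierstrassCurve ℚ) (_ : Wd.IsElliptic) (_ : Wd.IsGloballyMinimal)
        (Cd : WeierstrassCurve.VariableChange ℚ),
        WeierstrassCurve.Affine.Point.map ι.toRatAlgHom P = heegnerPointComplex Dt H ∧
          Cd • W.quadraticTwist (NumberField.discr K : ℚ) = Wd ∧ Nat.card (AddCommGroup.primaryComponent Wd.sha 2) = 4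

/-! ### Import-free glue: `L₁ ∧ SUPPLY₄ ⟹ R_N` -/

/-- `ord₂ 4 = 2`. -/
theorem padicValNat_two_four : padicValNat 2 4 = 2 := by
  have h : (4 : ℕ) = 2 ^ 2 := by norm_num
  rw [h, padicValNat.prime_pow]

/-- **The AN-28c identity at a `#Ш(Wd)[2^∞] = 4` minimal archimedean door of a `Ш(W)[2] = 0` curve holds with exponent `v₂(c) + 1`**:
`2(v₂(c)+1) + [Δ_W<0] = s_W + ord₂ 4 + t + 2s + 2v₂(c)` with `s_W = 0` (`padicValNat_card_primaryComponent_sha_two_eq_zero_of_shaTwoTrivial`), `[Δ_W<0] = 0`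
and `t + 2s = 0`.  Import-free arithmetic, isolated so that `omega` runs in a small context. [cite: GrossLMS1991, Conj. 1.2 and §3] -/
theorem lawful_identity_at_shaFourDoor (W Wd : WeierstrassCurve ℚ) [W.IsElliptic] [Wd.IsElliptic] (hSha : ShaTwoTrivial W) (hΔ : 0 < W.Δ)
    (h4 : Nat.card (AddCommGroup.primaryComponent Wd.sha 2) = 4) (t s : ℕ) (hmin : t + 2 * s = 0) (c : ℤ) :
    2 * (padicValInt 2 c + 1) + (if W.Δ < 0 then 1 else 0) =
      padicValNat 2 (Nat.card (AddCommGroup.primaryComponent W.sha 2)) +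
        padicValNat 2 (Nat.card (AddCommGroup.primaryComponent Wd.sha 2)) + t + 2 * s + 2 * padicValInt 2 c := by
  have hsW : padicValNat 2 (Nat.card (AddCommGroup.primaryComponent W.sha 2)) = 0 :=
    padicValNat_card_primaryComponent_sha_two_eq_zero_of_shaTwoTrivial W hSha
  have hsd : padicValNat 2 (Nat.card (AddCommGroup.primaryComponent Wd.sha 2)) = 2 := by
    rw [h4]; exact padicValNat_two_four
  have hneg : (if W.Δ < 0 then 1 else 0 : ℕ) = 0 := if_neg (not_lt.mpr (le_of_lt hΔ))
  omega

/-- **ES-27 GLUE: `L₁ ∧ SUPPLY₄ ⟹ R_N`** (`DoorIndexLawFullCAtTwoSomeDoorResidueNonEgg`).  At the supplied door the AN-28c identity holds with L₁'s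
exponent (`lawful_identity_at_shaFourDoor`).  Import-free bookkeeping; no printed fact is used: modulo L₁ and SUPPLY₄ the non-egg residue of LINE v8.17
closes, i.e. `stub_residueNonEgg ⟸ stub_L₁ ∘ stub_SUPPLY₄`. [cite: GrossLMS1991, Conj. 1.2 and §3] -/
theorem residueNonEgg_of_shaFourDoor (hL : HeegnerExponentAtShaFourMinimalDoorNonEggAtTwo) (hS : ShaFourMinimalDoorSupplyNonEggAtTwo) :
    DoorIndexLawFullCAtTwoSomeDoorResidueNonEgg := by
  intro W _ _ _ hCM hsurj hT hc hr hΔ hSha hegg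
  obtain ⟨K, iF, iN, hK, hadm, hmin, hcop, hHN, hL1, Dt, H, ι, P, Wd, iE, iG, Cd, hP, hWd, h4⟩ :=
    hS W hCM hsurj hT hc hr hΔ hSha hegg
  have hm : HasTwoDivisibilityUpToTorsion W K P (padicValInt 2 Dt.c + 1) :=
    hL W hCM hsurj hT hc hr hΔ hSha hegg K hK hadm hmin hcop hHN Wd Cd hWd h4 Dt H ι P hP
  refine ⟨K, iF, iN, hK, hadm, hL1, Dt, H, ι, P, Wd, iE, iG, Cd, hP, hWd, padicValInt 2 Dt.c + 1, hm, ?_⟩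
  exact lawful_identity_at_shaFourDoor W Wd hSha hΔ h4 _ _ hmin Dt.c

end Summit.BirchSwinnertonDyer.BirchSwinnertonDyer.Theorems.RankOneAtTwoOneDoor

end
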